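import Summits.QuantumFields.YangMills.Statement
import Literature.MathematicalPhysics.QuantumFieldTheory.MassGapFromLatticeClustering
import Literature.MathematicalPhysics.QuantumFieldTheory.SchwingerLimitInheritance
import Literature.MathematicalPhysics.QuantumFieldTheory.YangMillsOSOneSpecies

/-!
# SoloBlind: `YangMills` from lattice-only inputs — the continuum data `T` eliminated by compactness

`Summit.QuantumFields.YangMills` asks, for every compact simple `G`, for a faithful lattice
representation `r`, a weak-coupling scheme `sch` and Osterwalder–Schrader data `T` over ALL
gauge-invariant observables, with `IsYangMillsFor r sch T`, non-triviality and non-Gaussianity of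
`tr F²`, `T.HasMassGap Δ` and `HasLatticeMassGap r sch Δ`.

This file proves that the continuum object `T` carries NO independent content: `YangMills`
follows from purely LATTICE-side hypotheses on Wilson's theory (`LatticeInputs r`), namely, along
some scheme with `β_k → ∞` renormalising only the curvature species,

* the curvature `n`-point functions realised as tempered distributions `Λ k` agreeing with
  `latticeSchwinger` on real product tensors, with a `k`-UNIFORM E0′ bound on `⁰𝒮` (no convergence
  is assumed: a subsequence converges by compactness, and the statement only asks for existence
  along a sequence);
* E0 (normalisation, hermiticity), E2 (reflection positivity), E3 (symmetry) of `Λ k` for large `k`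
  (exact lattice facts: RP of Wilson's action, reality, commutativity);
* ASYMPTOTIC Euclidean invariance on `⁰𝒮`: translations (soft, `a_k → 0`, `a_k L_k → ∞`) and
  proper rotations (the open `SO(4)`-restoration input);
* spatial equi-clustering in the E4 binder form;
* Cauchy–Schwarz clustering `ClustersCS` at a physical rate `Δ > 0` (the transfer-matrix gap in
  physical units) and the all-observable, volume-uniform lattice gap `HasLatticeMassGap r sch Δ`
  — the infrared crux;
* two eventual LOWER bounds: a truncated two-point function and a connected three-point function
  of the curvature stay bounded away from `0` (non-triviality / non-Gaussianity witnesses).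

Assembly: diagonal extraction (`exists_strictMono_schwingerFamily_tendsto_of_linearGrowth`,
OS II §4), inheritance of E0/E0′/E2/E3 along pointwise limits on `⁰𝒮`
(`SchwingerLimitInheritance`), E1 and E4 from the asymptotic hypotheses, the continuum gap from
`OSData.hasMassGap_of_clustersCS`, and the extension by zero to all species
(`exists_yangMillsWitness_of_oneSpecies`). References: Osterwalder–Schrader, CMP 31 (1973) §3–4,
CMP 42 (1975) §2, §4; Glimm–Jaffe, *Quantum Physics* (1987) §6.1, §19; Jaffe–Witten (2000) §4–6.
-/

open scoped SchwartzMap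
open MeasureTheory Filter Topology ComplexConjugate
open Literature.MathematicalPhysics.AQFT Literature.MathematicalPhysics.QuantumLattice
open Literature.MathematicalPhysics.QuantumFieldTheory

noncomputable section

namespace Summit.QuantumFields.YangMills.Theorems.SoloBlind

/-! ### Sub-schemes along a strictly increasing reindexing -/

section SubScheme

variable {ι : Type}

/-- The scheme `sch` reindexed along a strictly increasing `φ : ℕ → ℕ` (a subsequence of spacings,
couplings, volumes and renormalisations). [folklore] -/
def subScheme (sch : SpeciesScheme ι) (φ : ℕ → ℕ) (hφ : StrictMono φ) : SpeciesScheme ι where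
  a := fun j => sch.a (φ j)
  a_pos := fun j => sch.a_pos (φ j)
  tendsto_a := sch.tendsto_a.comp hφ.tendsto_atTop
  β := fun j => sch.β (φ j)
  L := fun j => sch.L (φ j)
  tendsto_L := sch.tendsto_L.comp hφ.tendsto_atTop
  c := fun s j => sch.c s (φ j)
  m := fun s j => sch.m s (φ j)

/- The lattice `n`-point functions of the sub-scheme are those of the scheme, reindexed: this holds
by `rfl` and is used below in that form. -/

end SubScheme

/-! ### Lattice-only inputs -/

variable {G : Type} [Group G] [TopologicalSpace G] [IsTopologicalGroup G] [CompactSpace G]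
  [MeasurableSpace G] [BorelSpace G]

/-- **Lattice-only inputs** for the gauge group `G` in the faithful representation `r`: every field
is a statement about Wilson's lattice measure along the scheme `sch` (no continuum object). -/
structure LatticeInputs (r : LatticeRep G) where
  /-- the scheme: spacings, couplings, volumes, renormalisations -/
  sch : SpeciesScheme (YMSpecies G)
  /-- weak coupling `β_k → ∞` -/
  weak : sch.HasWeakCouplingLimit
  /-- only the curvature species is renormalised (all other `c_s ≡ 0`) -/
  onlyCurvature : ∀ s : YMSpecies G, s ≠ r.curvature → ∀ k, sch.c s k = 0
  /-- the curvature `n`-point functions at step `k` as tempered distributions -/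
  Λ : ℕ → SchwingerFamily (EuclideanSpace ℝ (Fin 4))
  /-- … agreeing with the lattice `n`-point functions on real product tensors -/
  agrees : ∀ (k n : ℕ) (f : Fin n → 𝓢(EuclideanSpace ℝ (Fin 4), ℝ)) (F : 𝓢((Fin n → EuclideanSpace ℝ (Fin 4)), ℂ)),
    IsTensorOf F (fun i => ofRealTest (f i)) →
      Λ k n F = ((latticeSchwinger r.ρ sch (fun s => s.F) k n (fun _ => r.curvature) f : ℝ) : ℂ)
  /-- `k`-uniform E0′ (linear growth) bound on `⁰𝒮` -/
  growth : ∃ (s : ℕ) (α β : ℝ), 0 ≤ α ∧ ∀ n, ∀ᶠ k in atTop, ∀ F : 𝓢((Fin n → EuclideanSpace ℝ (Fin 4)), ℂ),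
    IsOffDiagonal F → ‖Λ k n F‖ ≤ α * (n.factorial : ℝ) ^ β * schwartzNorm (n * s) F
  /-- E0 (normalisation) for large `k` -/
  normalized : ∀ᶠ k in atTop, (Λ k).toLabelled.IsNormalized
  /-- E0 (hermiticity) for large `k` -/
  hermitian : ∀ᶠ k in atTop, (Λ k).toLabelled.IsHermitian
  /-- E2 (reflection positivity) for large `k` (RP of Wilson's action) -/
  reflectionPositive : ∀ᶠ k in atTop, (Λ k).toLabelled.IsReflectionPositive
  /-- E3 (symmetry) for large `k` -/
  symmetric : ∀ᶠ k in atTop, (Λ k).toLabelled.IsSymmetric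
  /-- asymptotic translation invariance on `⁰𝒮` -/
  asympTranslation : ∀ (n : ℕ) (a : EuclideanSpace ℝ (Fin 4)) (F : 𝓢((Fin n → EuclideanSpace ℝ (Fin 4)), ℂ)), IsOffDiagonal F →
    Tendsto (fun k => Λ k n (translateMulti a F) - Λ k n F) atTop (𝓝 0)
  /-- asymptotic invariance under proper rotations on `⁰𝒮` (the open restoration input) -/
  asympRotation : ∀ (n : ℕ) (R : EuclideanSpace ℝ (Fin 4) ≃ₗᵢ[ℝ] EuclideanSpace ℝ (Fin 4)), LinearMap.det (R.toLinearEquiv : EuclideanSpace ℝ (Fin 4) →ₗ[ℝ] EuclideanSpace ℝ (Fin 4)) = 1 →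
    ∀ F : 𝓢((Fin n → EuclideanSpace ℝ (Fin 4)), ℂ), IsOffDiagonal F →
      Tendsto (fun k => Λ k n (linActMulti R F) - Λ k n F) atTop (𝓝 0)
  /-- spatial equi-clustering in the E4 binder form -/
  spatialCluster : ∀ (n m : ℕ) (F : 𝓢((Fin n → EuclideanSpace ℝ (Fin 4)), ℂ)) (G' : 𝓢((Fin m → EuclideanSpace ℝ (Fin 4)), ℂ)),
    IsTimeOrdered F → IsTimeOrdered G' → ∀ a : EuclideanSpace ℝ (Fin 4), a 0 = 0 → a ≠ 0 →
      ∀ H : ℝ → 𝓢((Fin (n + m) → EuclideanSpace ℝ (Fin 4)), ℂ),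
        (∀ t, IsAppendTensorOf (H t) (osAdjoint F) (translateMulti (t • a) G')) →
          ∀ ε : ℝ, 0 < ε → ∃ t₀ : ℝ, ∀ t, t₀ ≤ t → ∀ᶠ k in atTop,
            ‖Λ k (n + m) (H t) - Λ k n (osAdjoint F) * Λ k m G'‖ ≤ ε
  /-- the physical clustering rate -/
  Δ : ℝ
  /-- … is positive -/
  Δ_pos : 0 < Δ
  /-- Cauchy–Schwarz clustering of the curvature lattice functions at rate `Δ` -/
  csClustering : ClustersCS (d := 4) (ι := Unit)
    (fun k n _σ f => ((latticeSchwinger r.ρ sch (fun s => s.F) k n (fun _ => r.curvature) f : ℝ) : ℂ)) Δ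
  /-- THE CRUX: all-observable, volume-uniform lattice gap at rate `Δ a_k` in lattice units -/
  latticeGap : HasLatticeMassGap r sch Δ
  /-- eventual lower bound on a truncated two-point function (non-triviality witness) -/
  nontrivial : ∃ (F G' : 𝓢((Fin 1 → EuclideanSpace ℝ (Fin 4)), ℂ)) (H : 𝓢((Fin (1 + 1) → EuclideanSpace ℝ (Fin 4)), ℂ)) (ε : ℝ),
    IsTimeOrdered F ∧ IsTimeOrdered G' ∧ IsAppendTensorOf H (osAdjoint F) G' ∧ 0 < ε ∧
      ∀ᶠ k in atTop, ε ≤ ‖Λ k (1 + 1) H - Λ k 1 (osAdjoint F) * Λ k 1 G'‖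
  /-- eventual lower bound on a connected three-point function (non-Gaussianity witness) -/
  nonGaussian : ∃ (f g h : 𝓢(EuclideanSpace ℝ (Fin 4), ℂ)) (Ffgh : 𝓢((Fin 3 → EuclideanSpace ℝ (Fin 4)), ℂ))
    (Fgh Ffh Ffg : 𝓢((Fin 2 → EuclideanSpace ℝ (Fin 4)), ℂ)) (Ff Fg Fh : 𝓢((Fin 1 → EuclideanSpace ℝ (Fin 4)), ℂ)) (ε : ℝ),
    IsTensorOf Ffgh ![f, g, h] ∧ IsOffDiagonal Ffgh ∧
    IsTensorOf Fgh ![g, h] ∧ IsTensorOf Ffh ![f, h] ∧ IsTensorOf Ffg ![f, g] ∧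
    IsOffDiagonal Fgh ∧ IsOffDiagonal Ffh ∧ IsOffDiagonal Ffg ∧
    IsTensorOf Ff ![f] ∧ IsTensorOf Fg ![g] ∧ IsTensorOf Fh ![h] ∧ 0 < ε ∧
      ∀ᶠ k in atTop, ε ≤ ‖Λ k 3 Ffgh - Λ k 1 Ff * Λ k 2 Fgh - Λ k 1 Fg * Λ k 2 Ffh
        - Λ k 1 Fh * Λ k 2 Ffg + 2 * (Λ k 1 Ff * Λ k 1 Fg * Λ k 1 Fh)‖

namespace LatticeInputs

variable {r : LatticeRep G} (I : LatticeInputs r) {φ : ℕ → ℕ} (hφ : StrictMono φ)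
  {T : SchwingerFamily (EuclideanSpace ℝ (Fin 4))}
  (hconv : ∀ (n : ℕ) (F : 𝓢((Fin n → EuclideanSpace ℝ (Fin 4)), ℂ)), IsOffDiagonal F →
    Tendsto (fun j => I.Λ (φ j) n F) atTop (𝓝 (T n F)))

include hφ hconv

/-- E1, translations: the limit along a subsequence is translation invariant on `⁰𝒮`. -/
theorem translate_limit (n : ℕ) (a : EuclideanSpace ℝ (Fin 4)) (F : 𝓢((Fin n → EuclideanSpace ℝ (Fin 4)), ℂ)) (hF : IsOffDiagonal F) :
    T n (translateMulti a F) = T n F := by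
  have h := (hconv n _ (hF.translateMulti a)).sub (hconv n F hF)
  have h0 : Tendsto (fun j => I.Λ (φ j) n (translateMulti a F) - I.Λ (φ j) n F) atTop (𝓝 0) :=
    (I.asympTranslation n a F hF).comp hφ.tendsto_atTop
  exact sub_eq_zero.1 (tendsto_nhds_unique h h0)

/-- E1, rotations: the limit along a subsequence is invariant under proper rotations on `⁰𝒮`. -/
theorem rotate_limit (n : ℕ) (R : EuclideanSpace ℝ (Fin 4) ≃ₗᵢ[ℝ] EuclideanSpace ℝ (Fin 4))
    (hR : LinearMap.det (R.toLinearEquiv : EuclideanSpace ℝ (Fin 4) →ₗ[ℝ] EuclideanSpace ℝ (Fin 4)) = 1) (F : 𝓢((Fin n → EuclideanSpace ℝ (Fin 4)), ℂ))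
    (hF : IsOffDiagonal F) : T n (linActMulti R F) = T n F := by
  have hRF : IsOffDiagonal (linActMulti R F) :=
    hF.precomp
      (ContinuousLinearEquiv.piCongrRight fun _ : Fin n => R.symm.toContinuousLinearEquiv)
      (fun x hx => by
        obtain ⟨i, j, hij, hxij⟩ := hx
        exact ⟨i, j, hij, by simp [hxij]⟩)
      (fun _ => rfl)
  have h := (hconv n _ hRF).sub (hconv n F hF)
  have h0 : Tendsto (fun j => I.Λ (φ j) n (linActMulti R F) - I.Λ (φ j) n F) atTop (𝓝 0) :=
    (I.asympRotation n R hR F hF).comp hφ.tendsto_atTop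
  exact sub_eq_zero.1 (tendsto_nhds_unique h h0)

/-- E4: the limit along a subsequence has the cluster property (from spatial equi-clustering). -/
theorem hasClusterProperty_limit : T.toLabelled.HasClusterProperty := by
  intro n m k k' F G' hF hG' a ha0 ha H hH
  show Tendsto (fun t : ℝ => T (n + m) (H t) - T n (osAdjoint F) * T m G') atTop (𝓝 0)
  rw [NormedAddGroup.tendsto_nhds_zero]
  intro ε hε
  obtain ⟨t₀, ht₀⟩ := I.spatialCluster n m F G' hF hG' a ha0 ha H hH (ε / 2) (half_pos hε)
  refine Filter.eventually_atTop.2 ⟨t₀, fun t ht => ?_⟩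
  have hHt : IsOffDiagonal (H t) :=
    (hH t).isOffDiagonal_of_isTimeOrdered hF
      (OSReconstructionNoE1.isTimeOrdered_translateMulti hG' (b := t • a) (by simp [ha0]))
  have hlim : Tendsto (fun j => I.Λ (φ j) (n + m) (H t) - I.Λ (φ j) n (osAdjoint F) * I.Λ (φ j) m G')
      atTop (𝓝 (T (n + m) (H t) - T n (osAdjoint F) * T m G')) :=
    (hconv _ _ hHt).sub ((hconv _ _ hF.isOffDiagonal.osAdjoint).mul (hconv _ _ hG'.isOffDiagonal))
  have hle : ‖T (n + m) (H t) - T n (osAdjoint F) * T m G'‖ ≤ ε / 2 :=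
    le_of_tendsto ((continuous_norm.tendsto _).comp hlim) (hφ.tendsto_atTop.eventually (ht₀ t ht))
  exact hle.trans_lt (half_lt_self hε)

/-- The lattice `n`-point functions along the sub-scheme converge to the limit on off-diagonal real
product tensors. -/
theorem tendsto_latticeSchwinger_subScheme (n : ℕ) (f : Fin n → 𝓢(EuclideanSpace ℝ (Fin 4), ℝ))
    (F : 𝓢((Fin n → EuclideanSpace ℝ (Fin 4)), ℂ)) (hF : IsTensorOf F (fun i => ofRealTest (f i)))
    (hoff : IsOffDiagonal F) :
    Tendsto (fun j => ((latticeSchwinger r.ρ (subScheme I.sch φ hφ) (fun s => s.F) j n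
      (fun _ => r.curvature) f : ℝ) : ℂ)) atTop (𝓝 (T n F)) := by
  refine (hconv n F hoff).congr' (Eventually.of_forall fun j => ?_)
  show I.Λ (φ j) n F = ((latticeSchwinger r.ρ (subScheme I.sch φ hφ) (fun s => s.F) j n
    (fun _ => r.curvature) f : ℝ) : ℂ)
  rw [I.agrees (φ j) n f F hF]
  rfl

/-- Non-triviality of any OS data reading the limit. -/
theorem isNontrivial_limit (T₀ : OSData Unit 4)
    (hT₀ : ∀ (n : ℕ) (σ : Fin n → Unit) (F : 𝓢((Fin n → EuclideanSpace ℝ (Fin 4)), ℂ)), T₀.schwinger n σ F = T n F) :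
    T₀.IsNontrivial () := by
  obtain ⟨F, G', H, ε, hF, hG', hH, hε, hev⟩ := I.nontrivial
  refine ⟨F, G', H, hF, hG', hH, ?_⟩
  rw [hT₀, hT₀, hT₀]
  have hHo : IsOffDiagonal H := hH.isOffDiagonal_of_isTimeOrdered hF hG'
  have hlim : Tendsto (fun j => I.Λ (φ j) (1 + 1) H - I.Λ (φ j) 1 (osAdjoint F) * I.Λ (φ j) 1 G')
      atTop (𝓝 (T (1 + 1) H - T 1 (osAdjoint F) * T 1 G')) :=
    (hconv _ _ hHo).sub ((hconv _ _ hF.isOffDiagonal.osAdjoint).mul (hconv _ _ hG'.isOffDiagonal))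
  have hge : ε ≤ ‖T (1 + 1) H - T 1 (osAdjoint F) * T 1 G'‖ :=
    ge_of_tendsto ((continuous_norm.tendsto _).comp hlim) (hφ.tendsto_atTop.eventually hev)
  intro heq
  rw [heq, sub_self, norm_zero] at hge
  exact absurd hge (not_le.2 hε)

/-- Non-Gaussianity of any OS data reading the limit. -/
theorem isNonGaussian_limit (T₀ : OSData Unit 4)
    (hT₀ : ∀ (n : ℕ) (σ : Fin n → Unit) (F : 𝓢((Fin n → EuclideanSpace ℝ (Fin 4)), ℂ)), T₀.schwinger n σ F = T n F) :
    T₀.IsNonGaussian () := by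
  obtain ⟨f, g, hh, Ffgh, Fgh, Ffh, Ffg, Ff, Fg, Fh, ε, hFfgh, hoff3, hFgh, hFfh, hFfg, hoffgh,
    hofffh, hofffg, hFf, hFg, hFh, hε, hev⟩ := I.nonGaussian
  refine ⟨f, g, hh, Ffgh, Fgh, Ffh, Ffg, Ff, Fg, Fh, hFfgh, hoff3, hFgh, hFfh, hFfg, hFf, hFg, hFh,
    ?_⟩
  simp only [hT₀]
  have h1 : ∀ F1 : 𝓢((Fin 1 → EuclideanSpace ℝ (Fin 4)), ℂ), IsOffDiagonal F1 := fun F1 => isOffDiagonal_of_subsingleton F1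
  have hlim : Tendsto (fun j => I.Λ (φ j) 3 Ffgh - I.Λ (φ j) 1 Ff * I.Λ (φ j) 2 Fgh
      - I.Λ (φ j) 1 Fg * I.Λ (φ j) 2 Ffh - I.Λ (φ j) 1 Fh * I.Λ (φ j) 2 Ffg
      + 2 * (I.Λ (φ j) 1 Ff * I.Λ (φ j) 1 Fg * I.Λ (φ j) 1 Fh)) atTop
      (𝓝 (T 3 Ffgh - T 1 Ff * T 2 Fgh - T 1 Fg * T 2 Ffh - T 1 Fh * T 2 Ffg
        + 2 * (T 1 Ff * T 1 Fg * T 1 Fh))) :=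
    ((((hconv _ _ hoff3).sub ((hconv _ _ (h1 Ff)).mul (hconv _ _ hoffgh))).sub
      ((hconv _ _ (h1 Fg)).mul (hconv _ _ hofffh))).sub
      ((hconv _ _ (h1 Fh)).mul (hconv _ _ hofffg))).add
      ((((hconv _ _ (h1 Ff)).mul (hconv _ _ (h1 Fg))).mul (hconv _ _ (h1 Fh))).const_mul 2)
  have hge : ε ≤ ‖T 3 Ffgh - T 1 Ff * T 2 Fgh - T 1 Fg * T 2 Ffh - T 1 Fh * T 2 Ffg
      + 2 * (T 1 Ff * T 1 Fg * T 1 Fh)‖ :=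
    ge_of_tendsto ((continuous_norm.tendsto _).comp hlim) (hφ.tendsto_atTop.eventually hev)
  intro heq
  rw [heq, norm_zero] at hge
  exact absurd hge (not_le.2 hε)

omit hconv in
/-- Cauchy–Schwarz clustering passes to the sub-scheme. -/
theorem clustersCS_subScheme :
    ClustersCS 4 (ι := Unit) (fun j n _σ f => ((latticeSchwinger r.ρ (subScheme I.sch φ hφ)
      (fun s => s.F) j n (fun _ => r.curvature) f : ℝ) : ℂ)) I.Δ := by
  intro n m hn hm σ σ' N N' c c' p q hp hq t ht ε hε
  -- the sub-scheme's lattice functions at `j` are the scheme's at `φ j`, by `rfl`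
  exact hφ.tendsto_atTop.eventually (I.csClustering n m hn hm σ σ' N N' c c' p q hp hq t ht ε hε)

omit hconv in
/-- The continuum gap of any OS data that are the off-diagonal limit of the curvature lattice
functions along the sub-scheme (`OSData.hasMassGap_of_clustersCS`). -/
theorem hasMassGap_limit (T₀ : OSData Unit 4)
    (hconvT₀ : ∀ n : ℕ, n ≠ 0 → ∀ (f : Fin n → 𝓢(EuclideanSpace ℝ (Fin 4), ℝ)) (F : 𝓢((Fin n → EuclideanSpace ℝ (Fin 4)), ℂ)),
      IsTensorOf F (fun i => ofRealTest (f i)) → IsOffDiagonal F →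
        Tendsto (fun j : ℕ => ((latticeSchwinger r.ρ (subScheme I.sch φ hφ) (fun s => s.F) j n
          (fun _ => r.curvature) f : ℝ) : ℂ)) atTop (𝓝 (T₀.schwinger n (fun _ => ()) F))) :
    T₀.HasMassGap I.Δ :=
  OSData.hasMassGap_of_clustersCS T₀ (by norm_num)
    (fun j n _σ f => ((latticeSchwinger r.ρ (subScheme I.sch φ hφ) (fun s => s.F) j n
      (fun _ => r.curvature) f : ℝ) : ℂ))
    (fun n hn σ f F hF hoff => by
      have hσ : σ = fun _ => () := funext fun _ => rfl
      subst hσ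
      exact hconvT₀ n hn f F hF hoff)
    (I.clustersCS_subScheme hφ)

omit hφ hconv in
/-- **The Yang–Mills existential at `(G, r)` from lattice-only inputs.** -/
theorem exists_witness (I : LatticeInputs r) :
    ∃ (sch : SpeciesScheme (YMSpecies G)) (T : OSData (YMSpecies G) 4),
      sch.HasWeakCouplingLimit ∧ IsYangMillsFor r sch T ∧ T.IsNontrivial r.curvature ∧
        T.IsNonGaussian r.curvature ∧ ∃ Δ > 0, T.HasMassGap Δ ∧ HasLatticeMassGap r sch Δ := by
  -- Step 1: extraction of a convergent subsequence (compactness on `⁰𝒮`, OS II §4)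
  obtain ⟨s, α, β, hα, hgrowth⟩ := I.growth
  obtain ⟨φ, T, hφ, hconv, hlin, -⟩ :=
    exists_strictMono_schwingerFamily_tendsto_of_linearGrowth I.Λ s α β hα hgrowth
  have hφt : Tendsto φ atTop atTop := hφ.tendsto_atTop
  -- Step 2: the OS axioms of the limit
  have ax : OSAxiomsSchwinger T.toLabelled :=
    { normalized := isNormalized_of_tendsto hconv (hφt.eventually I.normalized)
      hermitian := isHermitian_of_tendsto hconv (hφt.eventually I.hermitian)
      invariant := ⟨fun n _ a F hF => I.translate_limit hφ hconv n a F hF,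
        fun n _ R hR F hF => I.rotate_limit hφ hconv n R hR F hF⟩
      reflectionPositive := isReflectionPositive_of_tendsto hconv
        (hφt.eventually I.reflectionPositive)
      symmetric := isSymmetric_of_tendsto hconv (hφt.eventually I.symmetric)
      cluster := I.hasClusterProperty_limit hφ hconv
      linearGrowth := hlin }
  let T₀ : OSData Unit 4 := OSData.ofAxioms T.toLabelled ax
  have hT₀ : ∀ (n : ℕ) (σ : Fin n → Unit) (F : 𝓢((Fin n → EuclideanSpace ℝ (Fin 4)), ℂ)),
      T₀.schwinger n σ F = T n F := fun _ _ _ => rfl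
  -- Step 3: convergence of the lattice functions along the sub-scheme to `T₀`
  have hconvT₀ : ∀ n : ℕ, n ≠ 0 → ∀ (f : Fin n → 𝓢(EuclideanSpace ℝ (Fin 4), ℝ)) (F : 𝓢((Fin n → EuclideanSpace ℝ (Fin 4)), ℂ)),
      IsTensorOf F (fun i => ofRealTest (f i)) → IsOffDiagonal F →
        Tendsto (fun j : ℕ => ((latticeSchwinger r.ρ (subScheme I.sch φ hφ) (fun s => s.F) j n
          (fun _ => r.curvature) f : ℝ) : ℂ)) atTop (𝓝 (T₀.schwinger n (fun _ => ()) F)) :=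
    fun n _ f F hF hoff => by
      rw [hT₀]; exact I.tendsto_latticeSchwinger_subScheme hφ hconv n f F hF hoff
  -- the all-observable lattice gap and weak coupling pass to the sub-scheme
  have hlat' : HasLatticeMassGap r (subScheme I.sch φ hφ) I.Δ := fun A B => by
    obtain ⟨C, hC⟩ := I.latticeGap A B
    exact ⟨C, hφt.eventually hC⟩
  have hweak' : (subScheme I.sch φ hφ).HasWeakCouplingLimit := I.weak.comp hφt
  -- Steps 4–6: gap, non-triviality, extension by zero to all species
  obtain ⟨T', hYM, hNT, hNG, Δ, hΔ, hgap, hlat⟩ :=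
    exists_yangMillsWitness_of_oneSpecies r (subScheme I.sch φ hφ)
      (fun s hs j => I.onlyCurvature s hs (φ j)) T₀ hconvT₀
      (I.isNontrivial_limit hφ hconv T₀ hT₀) (I.isNonGaussian_limit hφ hconv T₀ hT₀) I.Δ_pos
      (I.hasMassGap_limit hφ T₀ hconvT₀) hlat'
  exact ⟨subScheme I.sch φ hφ, T', hweak', hYM, hNT, hNG, Δ, hΔ, hgap, hlat⟩

end LatticeInputs

/-- **D1.** `YangMills` (Jaffe–Witten, Clay 2000, §4, in the tree's rendering) follows from
lattice-only inputs: for every compact simple `G`, a faithful unitary `r` with `LatticeInputs r`. -/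
theorem yangMills_of_latticeInputs
    (h : ∀ (G : Type) [Group G] [TopologicalSpace G] [IsTopologicalGroup G] [CompactSpace G],
      IsCompactSimpleLieGroup G →
        letI : MeasurableSpace G := borel G
        haveI : BorelSpace G := ⟨rfl⟩
        ∃ r : LatticeRep G, Nonempty (LatticeInputs r)) :
    YangMills := by
  intro G _ _ _ _ hG
  letI : MeasurableSpace G := borel G
  haveI : BorelSpace G := ⟨rfl⟩
  obtain ⟨r, ⟨I⟩⟩ := h G hG
  exact ⟨r, I.exists_witness⟩

end Summit.QuantumFields.YangMills.Theorems.SoloBlind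

end
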